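import Mathlib.MeasureTheory.Integral.IntervalIntegral.Basic
import Mathlib.MeasureTheory.Integral.Bochner.Set
import HarnessLib

/-!
# A uniform bound from an a.e.-restarted dissipative integral inequality

Analysis/FluidPDE support file (folklore real analysis; serves the discharge of
`Literature.Analysis.FluidPDE.timeAverage_isStationary`, Foias–Manley–Rosa–Temam 2001, Ch. IV
Thm. 3.1, where the trajectory of a Leray–Hopf solution must be shown to be bounded in `H`
uniformly in time, FMRT Ch. II (A.41)–(A.42): `|u(t)|² ≤ |u₀|² e^{-νλ₁t} + |f|²/(ν²λ₁²)`).

A Leray–Hopf weak solution only satisfies its energy inequality *from almost every* initial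
time `s` (and from `s = 0`), never a differential inequality. What the weak formulation delivers
for the energy `y(t) = |u(t)|²` (after Poincaré and Young) is the **restarted integral
inequality**

  `y(t) + a ∫_{(s,t]} y ≤ y(s) + C (t - s)` for every `s` in a set `G ∋ 0` of full measure
  in `[0, ∞)` and every `t ≥ s`,

with `a = νλ₁ > 0`, `C = |f|²/(νλ₁)`. This file proves the elementary consequence that is all the
time-average theory needs:

* `exists_forall_le_of_restart` — under the displayed hypothesis (with `y ≥ 0` locally
  integrable), `y` is bounded on `[0, ∞)`: `∃ R, ∀ t ≥ 0, y t ≤ R`.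

Proof (a discrete Grönwall argument through good times only): with `h = 4/a`, from a good time
`s` the inequality at `t = s + h` bounds `a ∫_{(s+h/2, s+h]} y ≤ y(s) + Ch`, so the mean of `y` over
that interval is `≤ (y(s) + Ch)/2`, and some *good* time `s' ∈ (s + h/2, s + h]` has
`y(s') ≤ (y(s) + Ch)/2 + 1` (good times have full measure). Iterating from `s₀ = 0` gives good
times `s_k → ∞` with gaps `≤ h` and `y(s_k) ≤ max(y(0), Ch + 2)`; between them `y ≤ y(s_k) + Ch`.
(The printed sources differentiate the energy equation of Galerkin/strong solutions instead,
FMRT 2001, Ch. II, App. A, (A.38)–(A.42); for a general Leray–Hopf solution only the a.e.-restarted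
form is available, cf. Robinson–Rodrigo–Sadowski 2016, Def. 4.9 and Thm. 4.6.)

## Mathlib search

Mathlib has Grönwall inequalities for functions with a derivative bound
(`Mathlib.Analysis.ODE.Gronwall`: `norm_le_gronwallBound_of_norm_deriv_right_le`) but nothing for
integral inequalities restarted from a.e. time (searched `gronwall`, `restart`, `integral_le`
in `Analysis/ODE`, `MeasureTheory`). The tree has the supremum two-point version
`Literature.Analysis.FluidPDE.le_mul_exp_of_two_point_sup` (`SupGronwall`) and the dissipative decay lemma
`Literature.Analysis.FluidPDE.tendsto_zero_of_integral_dissipative` (`ScalarEnergyCalculus`), neither of which applies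
to an a.e. set of initial times.

## References

* C. Foias, O. Manley, R. Rosa, R. Temam, *Navier–Stokes Equations and Turbulence*, Cambridge
  Univ. Press (2001), Ch. II App. A (A.38)–(A.42); Ch. IV §3.1 (3.2), (3.5). [FMRT2001]
* J. C. Robinson, J. L. Rodrigo, W. Sadowski, *The three-dimensional Navier–Stokes equations*,
  Cambridge Univ. Press (2016), Def. 4.9, Thm. 4.6. [RobinsonRodrigoSadowski2016]
-/

noncomputable section

open MeasureTheory Set Filter

namespace Literature.Analysis.FluidPDE

/-- **One restart step.** If `y ≥ 0` is integrable on `(s, s + h]`, `h = 4/a`, and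
`a ∫_{(s, s+h]} y ≤ Y + C h`, then some point `s'` of any full-measure set `G` of times in
`(s + h/2, s + h]` has `y(s') ≤ (Y + Ch)/2 + 1` (otherwise the mean of `y` over that
half-interval would exceed `(Y + Ch)/2`). [folklore] -/
theorem exists_mem_Ioc_le_of_setIntegral_le {y : ℝ → ℝ} {a C Y s : ℝ} (ha : 0 < a)
    (hy : ∀ t, 0 ≤ y t) (hyi : IntegrableOn y (Ioc s (s + 4 / a)))
    {G : Set ℝ} (hG : ∀ᵐ τ ∂volume, τ ∈ Ioc (s + 2 / a) (s + 4 / a) → τ ∈ G)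
    (hint : a * ∫ τ in Ioc s (s + 4 / a), y τ ≤ Y + C * (4 / a)) :
    ∃ s' ∈ G, s + 2 / a ≤ s' ∧ s' ≤ s + 4 / a ∧ y s' ≤ (Y + C * (4 / a)) / 2 + 1 := by
  by_contra hcon
  push Not at hcon
  set θ : ℝ := (Y + C * (4 / a)) / 2 + 1 with hθ
  set I : Set ℝ := Ioc (s + 2 / a) (s + 4 / a) with hI
  have h2a : 0 < 2 / a := by positivity
  have hIsub : I ⊆ Ioc s (s + 4 / a) := fun τ hτ => ⟨by linarith [hτ.1], hτ.2⟩
  have hyiI : IntegrableOn y I := hyi.mono_set hIsub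
  have hvolI : volume I = ENNReal.ofReal (2 / a) := by
    rw [hI, Real.volume_Ioc]
    congr 1
    ring
  have hvolI' : volume.real I = 2 / a := by
    rw [measureReal_def, hvolI, ENNReal.toReal_ofReal h2a.le]
  -- a.e. on `I`, `θ < y`
  have hae : ∀ᵐ τ ∂(volume.restrict I), θ ≤ y τ := by
    rw [ae_restrict_iff' measurableSet_Ioc]
    filter_upwards [hG] with τ hτG hτI
    exact (hcon τ (hτG hτI) hτI.1.le hτI.2).le
  -- hence `θ · (2/a) ≤ ∫_I y ≤ ∫_{(s, s+h]} y ≤ (Y + Ch)/a`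
  have h1 : θ * (2 / a) ≤ ∫ τ in I, y τ := by
    have hc : ∫ _ in I, θ = θ * (2 / a) := by
      rw [setIntegral_const, hvolI', smul_eq_mul, mul_comm]
    rw [← hc]
    refine integral_mono_ae ?_ hyiI hae
    exact integrableOn_const (by rw [hvolI]; exact ENNReal.ofReal_ne_top)
  have h2 : ∫ τ in I, y τ ≤ ∫ τ in Ioc s (s + 4 / a), y τ :=
    setIntegral_mono_set hyi (ae_of_all _ fun τ => hy τ) (ae_of_all _ hIsub)
  have h3 : a * (θ * (2 / a)) ≤ Y + C * (4 / a) :=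
    (mul_le_mul_of_nonneg_left (h1.trans h2) ha.le).trans hint
  have h4 : a * (θ * (2 / a)) = 2 * θ := by field_simp
  rw [h4, hθ] at h3
  linarith

/-- **Uniform bound from an a.e.-restarted dissipative integral inequality.** Let `y ≥ 0` be
integrable on every `(0, T]`, let `a > 0`, `C ≥ 0`, and let `G ⊆ [0, ∞)` contain `0` and almost
every positive time. If for every `s ∈ G` and every `t ≥ s`
`y(t) + a ∫_{(s,t]} y ≤ y(s) + C (t - s)`, then `y` is bounded on `[0, ∞)`. (The weak form of
FMRT 2001, Ch. II (A.41)–(A.42), `|u(t)|² ≤ |u₀|² e^{-νλ₁ t} + |f|²(νλ₁)⁻²(1 - e^{-νλ₁t})`, for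
energies that only satisfy the energy inequality from a.e. initial time; here without the
exponential rate, which the time-average theory does not use.) [folklore] -/
theorem exists_forall_le_of_restart {y : ℝ → ℝ} {a C : ℝ} (ha : 0 < a) (hC : 0 ≤ C)
    (hy : ∀ t, 0 ≤ y t) (hyi : ∀ T, IntegrableOn y (Ioc 0 T))
    {G : Set ℝ} (hG0 : G ⊆ Ici 0) (h0 : (0 : ℝ) ∈ G) (hG : ∀ᵐ s ∂volume, 0 < s → s ∈ G)
    (hyp : ∀ s ∈ G, ∀ t, s ≤ t → y t + a * ∫ τ in Ioc s t, y τ ≤ y s + C * (t - s)) :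
    ∃ R, ∀ t, 0 ≤ t → y t ≤ R := by
  -- notation: `h = 4/a`
  have h4a : 0 < 4 / a := by positivity
  have h2a : 0 < 2 / a := by positivity
  -- the restart step from a good time
  have hstep : ∀ s ∈ G, ∃ s' ∈ G, s + 2 / a ≤ s' ∧ s' ≤ s + 4 / a ∧
      y s' ≤ (y s + C * (4 / a)) / 2 + 1 := by
    intro s hs
    have hs0 : 0 ≤ s := hG0 hs
    refine exists_mem_Ioc_le_of_setIntegral_le ha hy ?_ ?_ ?_
    · exact (hyi (s + 4 / a)).mono_set (Ioc_subset_Ioc_left hs0)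
    · filter_upwards [hG] with τ hτ hτI
      exact hτ (by linarith [hτI.1])
    · have h := hyp s hs (s + 4 / a) (by linarith)
      have hnn : 0 ≤ y (s + 4 / a) := hy _
      rw [add_sub_cancel_left] at h
      linarith
  choose! nxt hnxtG hnxt using hstep
  -- the sequence of good times
  set seq : ℕ → ℝ := fun k => nxt^[k] 0 with hseq
  have hseq_succ : ∀ k, seq (k + 1) = nxt (seq k) := fun k => by
    simp only [hseq, Function.iterate_succ_apply']
  have hseqG : ∀ k, seq k ∈ G := by
    intro k
    induction k with
    | zero => simpa [hseq] using h0
    | succ k ih => rw [hseq_succ]; exact hnxtG _ ih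
  have hseq0 : seq 0 = 0 := by simp [hseq]
  have hgap : ∀ k, seq k + 2 / a ≤ seq (k + 1) ∧ seq (k + 1) ≤ seq k + 4 / a := fun k => by
    rw [hseq_succ]
    exact ⟨(hnxt _ (hseqG k)).1, (hnxt _ (hseqG k)).2.1⟩
  -- values at good times stay below `M`
  set M : ℝ := max (y 0) (C * (4 / a) + 2) with hM
  have hval : ∀ k, y (seq k) ≤ M := by
    intro k
    induction k with
    | zero => rw [hseq0]; exact le_max_left _ _
    | succ k ih =>
      rw [hseq_succ]
      refine (hnxt _ (hseqG k)).2.2.trans ?_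
      have hM2 : C * (4 / a) + 2 ≤ M := le_max_right _ _
      linarith
  -- the good times tend to infinity
  have hgrow : ∀ k : ℕ, (k : ℝ) * (2 / a) ≤ seq k := by
    intro k
    induction k with
    | zero => simp [hseq0]
    | succ k ih =>
      have := (hgap k).1
      push_cast
      linarith
  refine ⟨M + C * (4 / a), fun t ht => ?_⟩
  -- locate `t` between two consecutive good times
  have hex : ∃ k : ℕ, t < seq (k + 1) := by
    obtain ⟨k, hk⟩ := exists_nat_gt (t / (2 / a))
    refine ⟨k, lt_of_lt_of_le ?_ (hgrow (k + 1))⟩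
    rw [div_lt_iff₀ h2a] at hk
    push_cast
    nlinarith
  classical
  let k₀ := Nat.find hex
  have hk₀ : t < seq (k₀ + 1) := Nat.find_spec hex
  have hle : seq k₀ ≤ t := by
    rcases Nat.eq_zero_or_pos k₀ with hz | hpos
    · rw [hz, hseq0]; exact ht
    · have hmin := Nat.find_min hex (m := k₀ - 1) (Nat.sub_lt hpos one_pos)
      have hk : k₀ - 1 + 1 = k₀ := by omega
      rw [hk] at hmin
      exact le_of_not_gt hmin
  have hmain := hyp (seq k₀) (hseqG k₀) t hle
  have hint : 0 ≤ a * ∫ τ in Ioc (seq k₀) t, y τ :=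
    mul_nonneg ha.le (setIntegral_nonneg measurableSet_Ioc fun τ _ => hy τ)
  have hdt : t - seq k₀ ≤ 4 / a := by linarith [(hgap k₀).2]
  calc y t ≤ y (seq k₀) + C * (t - seq k₀) := by linarith
    _ ≤ M + C * (4 / a) := add_le_add (hval k₀) (mul_le_mul_of_nonneg_left hdt hC)

end Literature.Analysis.FluidPDE
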